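import Mathlib
import HarnessLib
import Literature.MathematicalPhysics.StatisticalMechanics.ComplexGradientStiffness
import Summits.HubbardSuperconductivity.HubbardSuperconductivity.Theorems.ComplexGFFStiffnessDefs
import Summits.HubbardSuperconductivity.HubbardSuperconductivity.Theorems.ComplexGFFStiffnessHypACumulantPertZBasic
import Summits.HubbardSuperconductivity.HubbardSuperconductivity.Theorems.ComplexGFFStiffnessHypACumulantZOfGNV
import Summits.HubbardSuperconductivity.HubbardSuperconductivity.Theorems.ComplexGFFStiffnessHypALocalTwoPointObservable
import Summits.HubbardSuperconductivity.HubbardSuperconductivity.Theorems.ComplexGFFStiffnessHypALocalTwoPointTranslation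
import Summits.HubbardSuperconductivity.HubbardSuperconductivity.Theorems.ComplexGFFStiffnessHypALocalTwoPointPertKLinear

/-!
# Crux `HypALocalTwoPoint`, line `gnv` — the reduction `OnePointLipschitz → TwoPointGivenZ`

Route `route-HubbardSuperconductivity-ComplexGFFStiffness`, crux item stmt-HubbardSuperconductivity-19155
(`…Theses.ComplexGFFStiffness.HypALocalTwoPoint`), registered stub `stub_twoPointGivenZ : TwoPointGivenZ`
(skeleton `Cruxes/HypALocalTwoPoint/Lines/gnv.lean`).  The stub — the `N`-uniform, `K`-uniform `O(g)`
bound on the nearest-neighbour cosine two-point function `⟨cos(∂_iφ(x)/√K)⟩_g` given non-vanishing —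
is an INSTANCE of the Lipschitz continuity of translation-averaged one-point functions in the
perturbation, `…Theorems.ComplexGFF.OnePointLipschitz` ([ABKM19] Theorem 2.2, `ℓ ≤ 2`, on the
`ι`-symmetric complex class; `Theorems/ComplexGFFStiffnessDefs`):

1. by translation invariance (`…HypALocalTwoPointTranslation`),
   `ev n g (cos(∂_iφ(x)/√K)) = onePoint n (pertK g) (cos(·_i/√K))` at every site `x`;
2. `𝒦_g = pertK g` is `ι`-admissible with Gaussian weight `exp(|z|²/8)` and size `B·g`
   (`…HypALocalTwoPointPertKLinear`), `𝒦_0 = 0`, and `‖𝒦_g − 𝒦_0‖ = ‖𝒦_g‖ ≤ B·g`;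
3. the observable `cos(z_i/√K)` is `ι`-admissible with weight `exp(|z|²/8)` and size `1`, uniformly in
   `K ≥ 1` (`…HypALocalTwoPointObservable.norm_iteratedFDeriv_cosObs_le_one`);
4. `pertZ n 𝒦_g = Z_n(g,0) ≠ 0` is the hypothesis of `TwoPointGivenZ`, `pertZ n 0 = Z_n(0,0) > 0`.

Hence `‖⟨cos⟩_g − ⟨cos⟩_0‖ ≤ C·(B·g)` with the constants `ρ(L), C(L)` of `OnePointLipschitz` and
`g₀(L) = min(1, ρ/B)`.

## Contents (all proved; no `sorry`, no new definition)
* `IsIotaAdmissibleWt.mono`, `isIotaAdmissible_of_wt_eighth`, `isIotaAdmissibleWt_zero`,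
  `isIotaAdmissibleWt_cosObs`, `isIotaAdmissibleWt_pertK` — bookkeeping of the weighted classes;
* `onePoint_pertK_eq_ev` — item 1;
* **`twoPointGivenZ_of_onePointLipschitz : OnePointLipschitz → TwoPointGivenZ`** — the reduction.

Honest scope: `OnePointLipschitz` itself (the `N`-uniform `C^{1,1}`-regularity of the finite-volume
free energy in the perturbation, i.e. bounded second differences of `log pertZ` along the tuned
renormalisation-group flow) is NOT proved here; it is the remaining content of the stub.

## References
* S. Adams, S. Buchholz, R. Kotecký, S. Müller, arXiv:1910.13564, Sec. 2.1, Theorem 2.2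
  [AdamsBuchholzKoteckyMuller2019].
-/

noncomputable section

-- `Summit.<Summit>.<Problem>`: single-conjunct summit, the duplicate component is mandated (D-0017).
set_option linter.dupNamespace false

namespace Summit.HubbardSuperconductivity.HubbardSuperconductivity.Theorems.ComplexGFF

open scoped BigOperators ComplexConjugate
open MeasureTheory
open Literature.MathematicalPhysics.StatisticalMechanics.ComplexGradientGFF4 (Z ev D S w)

variable {n : ℕ}

/-! ### Bookkeeping of the weighted admissibility classes -/

/-- monotonicity of `IsIotaAdmissibleWt` in the size. -/
theorem IsIotaAdmissibleWt.mono {r₀ : ℕ} {a ρ ρ' : ℝ} {K : (Fin 4 → ℝ) → ℂ}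
    (hK : IsIotaAdmissibleWt r₀ a ρ K) (hρ : ρ ≤ ρ') : IsIotaAdmissibleWt r₀ a ρ' K := by
  obtain ⟨hd, hb, hι⟩ := hK
  exact ⟨hd, fun k hk z => (hb k hk z).trans
    (mul_le_mul_of_nonneg_right hρ (Real.exp_pos _).le), hι⟩

/-- the class with Gaussian weight `exp(|z|²/8)` is contained in the reference's class
`IsIotaAdmissible` (weight `exp(|z|²/4)`) with the same size. -/
theorem isIotaAdmissible_of_wt_eighth {r₀ : ℕ} {ρ : ℝ} (hρ : 0 ≤ ρ) {K : (Fin 4 → ℝ) → ℂ}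
    (hK : IsIotaAdmissibleWt r₀ (1 / 8) ρ K) : IsIotaAdmissible r₀ ρ K := by
  obtain ⟨hd, hb, hι⟩ := hK
  refine ⟨hd, fun k hk z => (hb k hk z).trans (mul_le_mul_of_nonneg_left ?_ hρ), hι⟩
  exact Real.exp_le_exp.mpr (by
    have h0 : 0 ≤ ∑ i : Fin 4, (z i) ^ 2 := Finset.sum_nonneg (fun i _ => sq_nonneg _)
    linarith)

/-- the zero perturbation is admissible with every nonnegative size. -/
theorem isIotaAdmissibleWt_zero (r₀ : ℕ) (a : ℝ) {ρ : ℝ} (hρ : 0 ≤ ρ) :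
    IsIotaAdmissibleWt r₀ a ρ (fun _ : Fin 4 → ℝ => (0 : ℂ)) := by
  refine ⟨contDiff_const, fun k _ z => ?_, fun z => by simp⟩
  rw [iteratedFDeriv_fun_zero, Pi.zero_apply, norm_zero]
  positivity

/-- **the cosine observable is admissible with weight `exp(|z|²/8)` and size `1`, uniformly in
`K ≥ 1`**: all its derivatives have norm `≤ 1`, it is real and even. -/
theorem isIotaAdmissibleWt_cosObs (r₀ : ℕ) {κ : ℝ} (hκ : 1 ≤ κ) (i : Fin 4) :
    IsIotaAdmissibleWt r₀ (1 / 8) 1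
      (fun z : Fin 4 → ℝ => ((Real.cos (z i / Real.sqrt κ) : ℝ) : ℂ)) := by
  refine ⟨contDiff_cosObs hκ i, fun k _ z => ?_, fun z => ?_⟩
  · have h1 : (1 : ℝ) ≤ 1 * Real.exp (1 / 8 * ∑ i : Fin 4, (z i) ^ 2) := by
      rw [one_mul]
      exact Real.one_le_exp (by positivity)
    exact (norm_iteratedFDeriv_cosObs_le_one hκ i k z).trans h1
  · have hc : Real.cos ((-z) i / Real.sqrt κ) = Real.cos (z i / Real.sqrt κ) := by
      rw [Pi.neg_apply, neg_div, Real.cos_neg]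
    show ((Real.cos ((-z) i / Real.sqrt κ) : ℝ) : ℂ) = conj ((Real.cos (z i / Real.sqrt κ) : ℝ) : ℂ)
    rw [hc, Complex.conj_ofReal]

/-- **the model's perturbation is admissible with weight `exp(|z|²/8)` and size `B·g`**
(`0 ≤ g ≤ 1`, `B` from `norm_iteratedFDeriv_pertK_le_linear_weighted`). -/
theorem isIotaAdmissibleWt_pertK (r₀ : ℕ) :
    ∃ B : ℝ, 0 < B ∧ ∀ g : ℝ, 0 ≤ g → g ≤ 1 → IsIotaAdmissibleWt r₀ (1 / 8) (B * g) (pertK g) := by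
  obtain ⟨B, hB, hBle⟩ := norm_iteratedFDeriv_pertK_le_linear_weighted r₀
  exact ⟨B, hB, fun g hg0 hg1 =>
    ⟨contDiff_pertK g, fun k hk z => hBle g hg0 hg1 k hk z, fun z => pertK_neg g z⟩⟩

/-! ### The one-point function of the model is the expectation `ev` -/

/-- continuity of the lattice gradient in the field. -/
theorem continuous_D_apply (i : Fin 4) (x : Fin 4 → ZMod n) :
    Continuous (fun φ : (Fin 4 → ZMod n) → ℝ => D φ i x) := by
  unfold D; fun_prop

/-- `‖𝒦_g(z)‖ ≤ 3g·C·e^{|z|²/4}` in the reference's weight (for the integrability lemma of `pertZ`). -/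
theorem norm_pertK_le_weight {g : ℝ} (hg : 0 ≤ g) :
    ∃ ρ : ℝ, 0 ≤ ρ ∧ ∀ z : Fin 4 → ℝ, ‖pertK g z‖ ≤ ρ * Real.exp ((∑ i : Fin 4, (z i) ^ 2) / 4) := by
  obtain ⟨C, hC, hCle⟩ := one_add_pow_le_exp 3
  refine ⟨3 * g * C, by positivity, fun z => ?_⟩
  have hz : 0 ≤ ‖z‖ := norm_nonneg z
  have h1 : ‖z‖ ^ 3 ≤ (1 + ‖z‖) ^ 3 := pow_le_pow_left₀ hz (by linarith) 3
  have h2 : (1 + ‖z‖) ^ 3 ≤ C * Real.exp ((∑ i : Fin 4, (z i) ^ 2) / 4) :=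
    (hCle ‖z‖ hz).trans (mul_le_mul_of_nonneg_left
      (Real.exp_le_exp.mpr (by linarith [norm_sq_le_sum_sq z])) hC.le)
  calc ‖pertK g z‖ ≤ 3 * g * ‖z‖ ^ 3 := norm_pertK_le hg z
    _ ≤ 3 * g * (C * Real.exp ((∑ i : Fin 4, (z i) ^ 2) / 4)) :=
        mul_le_mul_of_nonneg_left (h1.trans h2) (by positivity)
    _ = 3 * g * C * Real.exp ((∑ i : Fin 4, (z i) ^ 2) / 4) := by ring

/-- **Item 1 of the reduction**: for a bounded continuous local gradient observable `G` and the
model's perturbation `𝒦_g` (`g ≥ 0`), the translation-averaged one-point function is the expectation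
at any site: `onePoint n (pertK g) G = ev n g (G(∇φ(x)))`. -/
theorem onePoint_pertK_eq_ev [NeZero n] {g : ℝ} (hg : 0 ≤ g) {G : (Fin 4 → ℝ) → ℂ}
    (hGc : Continuous G) {M : ℝ} (hGb : ∀ z, ‖G z‖ ≤ M) (x : Fin 4 → ZMod n) :
    onePoint n (pertK g) G = ev n g (fun φ => G (fun i => D φ i x)) := by
  obtain ⟨ρ, hρ, hK⟩ := norm_pertK_le_weight hg
  have hW := integrable_pertZ_integrand n (contDiff_pertK (m := 0) g).continuous hρ hK
  have hint : ∀ y : Fin 4 → ZMod n, Integrable (fun φ : (Fin 4 → ZMod n) → ℝ =>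
      G (fun i => D φ i y) * (Complex.exp (-((S 0 φ : ℝ) : ℂ)) *
        ∏ z : Fin 4 → ZMod n, (1 + pertK g (fun i => D φ i z)))) := by
    intro y
    refine hW.bdd_mul ?_ (Filter.Eventually.of_forall (fun φ => hGb _))
    exact (hGc.comp (continuous_pi (fun i => continuous_D_apply i y))).aestronglyMeasurable
  have hcard : (Fintype.card (Fin 4 → ZMod n) : ℂ) ≠ 0 :=
    Nat.cast_ne_zero.mpr Fintype.card_ne_zero
  unfold onePoint
  rw [integral_sum_obs_mul_weight (pertK g) G x hint, ev_gradObs_eq_div_pertZ,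
    mul_div_mul_left _ _ hcard]

/-! ### The reduction -/

/-- **`OnePointLipschitz → TwoPointGivenZ`** (module docstring): the registered stub
`stub_twoPointGivenZ` of the crux `HypALocalTwoPoint` follows from the `N`-uniform Lipschitz
continuity of the one-point functions in the perturbation, with the same `L₀` and, for each odd base
`L`, the threshold `g₀(L) = min(1, ρ(L)/B)` and the constant `C(L)·B`. -/
theorem twoPointGivenZ_of_onePointLipschitz (h : OnePointLipschitz) : TwoPointGivenZ := by
  obtain ⟨r₀, L₀, hL⟩ := h
  obtain ⟨B, hB, hBadm⟩ := isIotaAdmissibleWt_pertK r₀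
  refine ⟨L₀, fun L hodd hle => ?_⟩
  obtain ⟨ρ, C, hρ, hN⟩ := hL L hodd hle
  refine ⟨min 1 (ρ / B), C * B, lt_min one_pos (div_pos hρ hB), ?_⟩
  intro g hg0 hg N hN1 n _ hn hZ K hK x i
  have hg1 : g ≤ 1 := hg.trans (min_le_left _ _)
  have hgρ : B * g ≤ ρ := by
    have h := hg.trans (min_le_right _ _)
    rw [le_div_iff₀ hB] at h
    linarith [mul_comm g B]
  -- the data of `OnePointLipschitz`
  have hKg : IsIotaAdmissibleWt r₀ (1 / 8) (B * g) (pertK g) := hBadm g hg0 hg1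
  have hKρ : IsIotaAdmissibleWt r₀ (1 / 8) ρ (pertK g) := hKg.mono hgρ
  have h0 : IsIotaAdmissibleWt r₀ (1 / 8) ρ (fun _ : Fin 4 → ℝ => (0 : ℂ)) :=
    isIotaAdmissibleWt_zero r₀ _ hρ.le
  have hG := isIotaAdmissibleWt_cosObs r₀ hK i
  have hdiff : IsIotaAdmissibleWt r₀ (1 / 8) (B * g)
      (fun z => pertK g z - (fun _ : Fin 4 → ℝ => (0 : ℂ)) z) := by
    simp only [sub_zero]
    exact hKg
  have hZg : pertZ n (pertK g) ≠ 0 := by rwa [pertZ_pertK]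
  have hZ0 : pertZ n (fun _ : Fin 4 → ℝ => (0 : ℂ)) ≠ 0 := by
    intro h0'
    have hpos := (pertZ_zero_pos n).1
    rw [h0', Complex.zero_re] at hpos
    exact lt_irrefl _ hpos
  have hmain := hN N hN1 n hn (pertK g) (fun _ => (0 : ℂ))
    (fun z : Fin 4 → ℝ => ((Real.cos (z i / Real.sqrt K) : ℝ) : ℂ)) (B * g)
    hKρ h0 hG (by positivity) hdiff hZg hZ0
  -- both one-point functions are the expectations of `TwoPointGivenZ`
  have hGc : Continuous (fun z : Fin 4 → ℝ => ((Real.cos (z i / Real.sqrt K) : ℝ) : ℂ)) :=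
    (contDiff_cosObs (m := 0) hK i).continuous
  have hGb : ∀ z : Fin 4 → ℝ, ‖((Real.cos (z i / Real.sqrt K) : ℝ) : ℂ)‖ ≤ 1 := fun z => by
    rw [Complex.norm_real, Real.norm_eq_abs]
    exact Real.abs_cos_le_one _
  have hev : ∀ g' : ℝ, 0 ≤ g' →
      onePoint n (pertK g') (fun z : Fin 4 → ℝ => ((Real.cos (z i / Real.sqrt K) : ℝ) : ℂ))
        = ev n g' (fun φ => ((Real.cos (D φ i x / Real.sqrt K) : ℝ) : ℂ)) :=
    fun g' hg' => onePoint_pertK_eq_ev hg' hGc hGb x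
  rw [show (fun _ : Fin 4 → ℝ => (0 : ℂ)) = pertK 0 from pertK_zero.symm, hev g hg0,
    hev 0 le_rfl] at hmain
  calc ‖ev n g (fun φ => ((Real.cos (D φ i x / Real.sqrt K) : ℝ) : ℂ))
        - ev n 0 (fun φ => ((Real.cos (D φ i x / Real.sqrt K) : ℝ) : ℂ))‖
      ≤ C * (B * g) := hmain
    _ = C * B * g := by ring

end Summit.HubbardSuperconductivity.HubbardSuperconductivity.Theorems.ComplexGFF

end
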